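import Mathlib
import HarnessLib
import Summits.Ventures.LatticeQCDFlow.Exactness.OpenBoundaryChargeDensity
import Summits.Ventures.LatticeQCDFlow.Scoring.WilsonFlowAxisPermutationCovariance
import Summits.Ventures.LatticeQCDFlow.Scoring.WilsonFlowReflectionCovariance

/-!
# The FLOWED slab charges of the open lattice have symmetric laws, for every placement of the open direction and every flow time

HONEST FRAMING: exact (Metropolis-corrected) sampling algorithms for lattice gauge theory;
figures of merit are autocorrelation/cost numbers at stated couplings and volumes; no
continuum-physics claim.

Venture `LatticeQCDFlow` (cell pub-lqcd), topic `Exactness`, FANOUT row 21 (`su3-base`, arm `OBC-HMC`: the charge is measured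
AFTER Wilson flow, summed over a window of slices away from the open boundary).  NEW WORK of the cell, def-free, assembling
row 21's `OpenBoundaryChargeDensity` (slab charges of the BARE field: `Q_S` odd under `configPerm (swap 1 2)` / `Θ'` for
symmetric `S`, `sitePerm_swap_mem_slices`, `negReflect_mem_slices`, `measurePreserving_configPerm_obcGibbs`),
`OpenBoundaryTranslation` (`measurePreserving_negReflect_obcGibbs`, `isProbabilityMeasure_obcGibbs`), row 21's
`Scoring/WilsonFlowAxisPermutationCovariance` (`wilsonFlow_configPerm`) and row 16's `Scoring/WilsonFlowReflectionCovariance`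
(`wilsonFlow_negReflect`), over the Literature's `SU(n)` Wilson flow `wilsonFlow t U` (`measurable_wilsonFlow`).
Nothing is cited as a fact; no number.

## What is proved (`SU(n)` on `(ℤ/L)^4`, fundamental representation, every `L ≥ 1`, every real `β` and flow time `t`)

* §1 `cloverPseudoscalar_wilsonFlow_configPerm_swap` — `P_x(V_t(configPerm s U)) = −P_{s x}(V_t U)`, `s = sitePerm (swap 1 2)`:
  the flowed clover charge density is a pseudoscalar under the axis transposition too; `sum_cloverPseudoscalar_wilsonFlow_configPerm_swap`,
  `sum_cloverPseudoscalar_wilsonFlow_negReflect_of_symm` — the flowed charge `Q_{S,t}(U) = Σ_{x∈S} P_x(V_t U)` of an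
  `s`-symmetric (resp. `θ'`-symmetric) finite set of sites is odd under `configPerm s` (resp. `Θ'`);
  `measurable_flowedCharge` (measurability of `Q_{S,t}`).
* §2 **`obcGibbs_map_flowedCharge_neg_invariant_of_dir_zero`** / **`_of_ne_zero`** — under the open-boundary Gibbs law the
  law of `Q_{S,t}` is symmetric about `0` (open direction `0` and `s`-symmetric `S`, resp. `τ ≠ 0` and `θ'`-symmetric `S`);
  **`obcGibbs_map_flowedSlabCharge_neg_invariant`** — FOR EVERY OPEN DIRECTION `τ`, EVERY SET OF SLICES `W` AND EVERY FLOW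
  TIME `t`, the flowed slab charge `Q_{W,t} = Σ_{x : x_τ ∈ W} P_x(V_t U)` has a symmetric law; `obcGibbs_flowedSlabCharge_pow_odd_eq_zero`
  (odd moments vanish), `obcGibbs_flowedSlabCharge_integral_eq_zero` (`⟨Q_{W,t}⟩_OBC = 0`).
So the run check "histogram of the flowed sub-volume charge symmetric, mean zero" is exact for the target at every flow time and
every window, boundary slices included or not.  NOT CLAIMED: integrality or the `t → ∞` behaviour of `Q_{W,t}`; even moments;
the open-boundary variant of the flow equation (the flow here is the torus flow of the Literature applied to the sampled
field); numbers.
-/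

noncomputable section

namespace Summit.Ventures.LatticeQCDFlow.Exactness

open MeasureTheory Set Function
open Literature.MathematicalPhysics.QuantumFieldTheory
open Literature.MathematicalPhysics.QuantumLattice (cloverPseudoscalar measurable_cloverPseudoscalar fundamentalRep
  continuous_fundamentalRep fundamentalRep_mem_unitaryGroup)
open scoped ENNReal

/-! ## §1 The flowed charge of a symmetric set of sites is odd -/

section Odd

variable {L n : ℕ} [NeZero L]

/-- **The flowed clover charge density is a pseudoscalar under the axis transposition**:
`P_x(V_t(configPerm s U)) = −P_{s x}(V_t U)`, `s = sitePerm (swap 1 2)`. -/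
theorem cloverPseudoscalar_wilsonFlow_configPerm_swap (t : ℝ) (U : GaugeConfig 4 L (Matrix.specialUnitaryGroup (Fin n) ℂ))
    (x : Site 4 L) :
    cloverPseudoscalar (fundamentalRep (Fin n)) x (wilsonFlow t (configPerm (Equiv.swap (1 : Fin 4) 2) U)) =
      -cloverPseudoscalar (fundamentalRep (Fin n)) (sitePerm (Equiv.swap (1 : Fin 4) 2) x) (wilsonFlow t U) := by
  rw [Scoring.wilsonFlow_configPerm]
  exact cloverPseudoscalar_configPerm_swap (fundamentalRep (Fin n)) fundamentalRep_mem_unitaryGroup (wilsonFlow t U) x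

/-- **`Q_{S,t}(configPerm s U) = −Q_{S,t}(U)`** for every `s`-symmetric finite set of sites. -/
theorem sum_cloverPseudoscalar_wilsonFlow_configPerm_swap (t : ℝ) {S : Finset (Site 4 L)}
    (hS : ∀ x ∈ S, sitePerm (Equiv.swap (1 : Fin 4) 2) x ∈ S) (U : GaugeConfig 4 L (Matrix.specialUnitaryGroup (Fin n) ℂ)) :
    ∑ x ∈ S, cloverPseudoscalar (fundamentalRep (Fin n)) x (wilsonFlow t (configPerm (Equiv.swap (1 : Fin 4) 2) U)) =
      -∑ x ∈ S, cloverPseudoscalar (fundamentalRep (Fin n)) x (wilsonFlow t U) := by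
  rw [Scoring.wilsonFlow_configPerm]
  exact sum_cloverPseudoscalar_configPerm_swap (fundamentalRep (Fin n)) fundamentalRep_mem_unitaryGroup hS (wilsonFlow t U)

/-- **`Q_{S,t}(Θ'U) = −Q_{S,t}(U)`** for every `θ'`-symmetric finite set of sites. -/
theorem sum_cloverPseudoscalar_wilsonFlow_negReflect_of_symm (t : ℝ) {S : Finset (Site 4 L)}
    (hS : ∀ x ∈ S, x.negReflect ∈ S) (U : GaugeConfig 4 L (Matrix.specialUnitaryGroup (Fin n) ℂ)) :
    ∑ x ∈ S, cloverPseudoscalar (fundamentalRep (Fin n)) x (wilsonFlow t U.negReflect) =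
      -∑ x ∈ S, cloverPseudoscalar (fundamentalRep (Fin n)) x (wilsonFlow t U) := by
  rw [Scoring.wilsonFlow_negReflect]
  exact sum_cloverPseudoscalar_negReflect_of_symm (fundamentalRep (Fin n)) fundamentalRep_mem_unitaryGroup hS (wilsonFlow t U)

/-- The flowed charge of a finite set of sites is measurable in the initial field. -/
theorem measurable_flowedCharge (t : ℝ) (S : Finset (Site 4 L)) :
    Measurable fun U : GaugeConfig 4 L (Matrix.specialUnitaryGroup (Fin n) ℂ) =>
      ∑ x ∈ S, cloverPseudoscalar (fundamentalRep (Fin n)) x (wilsonFlow t U) :=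
  Finset.measurable_sum S fun x _ =>
    (measurable_cloverPseudoscalar (fundamentalRep (Fin n)) (continuous_fundamentalRep (Fin n)) x).comp
      (measurable_wilsonFlow t)

end Odd

/-! ## §2 Symmetric laws of the flowed slab charges under the open-boundary Gibbs law -/

section Law

variable {L n : ℕ} [NeZero L]

/-- **Open direction `0`, `s`-symmetric `S`: the law of the flowed charge `Q_{S,t}` is symmetric about `0`.** -/
theorem obcGibbs_map_flowedCharge_neg_invariant_of_dir_zero (β t : ℝ) {S : Finset (Site 4 L)}
    (hS : ∀ x ∈ S, sitePerm (Equiv.swap (1 : Fin 4) 2) x ∈ S) :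
    ((gibbsProbability (Measure.pi fun _ : Edge 4 L => haarProbability (Matrix.specialUnitaryGroup (Fin n) ℂ))
        (fun U => Real.exp (-(β * obcAction (fundamentalRep (Fin n)) 0 U)))).map
        (fun U => ∑ x ∈ S, cloverPseudoscalar (fundamentalRep (Fin n)) x (wilsonFlow t U))).map Neg.neg =
      (gibbsProbability (Measure.pi fun _ : Edge 4 L => haarProbability (Matrix.specialUnitaryGroup (Fin n) ℂ))
        (fun U => Real.exp (-(β * obcAction (fundamentalRep (Fin n)) 0 U)))).map
        (fun U => ∑ x ∈ S, cloverPseudoscalar (fundamentalRep (Fin n)) x (wilsonFlow t U)) :=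
  Scoring.map_neg_map_of_odd _ (measurePreserving_configPerm_obcGibbs (Equiv.swap (1 : Fin 4) 2) (fundamentalRep (Fin n))
      (continuous_fundamentalRep (Fin n)) (Equiv.swap_apply_of_ne_of_ne (by decide) (by decide)) β)
    (measurable_flowedCharge t S).aemeasurable (sum_cloverPseudoscalar_wilsonFlow_configPerm_swap t hS)

/-- **Open direction `τ ≠ 0`, `θ'`-symmetric `S`: the law of the flowed charge `Q_{S,t}` is symmetric about `0`.** -/
theorem obcGibbs_map_flowedCharge_neg_invariant_of_ne_zero {τ : Fin 4} (hτ : τ ≠ 0) (β t : ℝ) {S : Finset (Site 4 L)}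
    (hS : ∀ x ∈ S, x.negReflect ∈ S) :
    ((gibbsProbability (Measure.pi fun _ : Edge 4 L => haarProbability (Matrix.specialUnitaryGroup (Fin n) ℂ))
        (fun U => Real.exp (-(β * obcAction (fundamentalRep (Fin n)) τ U)))).map
        (fun U => ∑ x ∈ S, cloverPseudoscalar (fundamentalRep (Fin n)) x (wilsonFlow t U))).map Neg.neg =
      (gibbsProbability (Measure.pi fun _ : Edge 4 L => haarProbability (Matrix.specialUnitaryGroup (Fin n) ℂ))
        (fun U => Real.exp (-(β * obcAction (fundamentalRep (Fin n)) τ U)))).map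
        (fun U => ∑ x ∈ S, cloverPseudoscalar (fundamentalRep (Fin n)) x (wilsonFlow t U)) :=
  Scoring.map_neg_map_of_odd _ (measurePreserving_negReflect_obcGibbs (fundamentalRep (Fin n))
      (continuous_fundamentalRep (Fin n)) hτ β)
    (measurable_flowedCharge t S).aemeasurable (sum_cloverPseudoscalar_wilsonFlow_negReflect_of_symm t hS)

/-- **THE FLOWED SLAB CHARGE HAS A SYMMETRIC LAW FOR EVERY PLACEMENT OF THE OPEN DIRECTION, EVERY WINDOW AND EVERY FLOW
TIME**: the law of `Q_{W,t} = Σ_{x : x_τ ∈ W} P_x(V_t U)` under the open-boundary Gibbs law is symmetric about `0`. -/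
theorem obcGibbs_map_flowedSlabCharge_neg_invariant (τ : Fin 4) (W : Finset (ZMod L)) (β t : ℝ) :
    ((gibbsProbability (Measure.pi fun _ : Edge 4 L => haarProbability (Matrix.specialUnitaryGroup (Fin n) ℂ))
        (fun U => Real.exp (-(β * obcAction (fundamentalRep (Fin n)) τ U)))).map
        (fun U => ∑ x ∈ Finset.univ.filter (fun y : Site 4 L => y τ ∈ W),
          cloverPseudoscalar (fundamentalRep (Fin n)) x (wilsonFlow t U))).map Neg.neg =
      (gibbsProbability (Measure.pi fun _ : Edge 4 L => haarProbability (Matrix.specialUnitaryGroup (Fin n) ℂ))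
        (fun U => Real.exp (-(β * obcAction (fundamentalRep (Fin n)) τ U)))).map
        (fun U => ∑ x ∈ Finset.univ.filter (fun y : Site 4 L => y τ ∈ W),
          cloverPseudoscalar (fundamentalRep (Fin n)) x (wilsonFlow t U)) := by
  by_cases hτ : τ = 0
  · subst hτ
    exact obcGibbs_map_flowedCharge_neg_invariant_of_dir_zero β t (sitePerm_swap_mem_slices W)
  · exact obcGibbs_map_flowedCharge_neg_invariant_of_ne_zero hτ β t (negReflect_mem_slices hτ W)

/-- **Odd moments of every flowed slab charge vanish**: `⟨Q_{W,t}^{2k+1}⟩_OBC = 0`, every open direction, window, flow time. -/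
theorem obcGibbs_flowedSlabCharge_pow_odd_eq_zero (τ : Fin 4) (W : Finset (ZMod L)) (β t : ℝ) (k : ℕ) :
    ∫ U, (∑ x ∈ Finset.univ.filter (fun y : Site 4 L => y τ ∈ W),
        cloverPseudoscalar (fundamentalRep (Fin n)) x (wilsonFlow t U)) ^ (2 * k + 1)
      ∂(gibbsProbability (Measure.pi fun _ : Edge 4 L => haarProbability (Matrix.specialUnitaryGroup (Fin n) ℂ))
        (fun U => Real.exp (-(β * obcAction (fundamentalRep (Fin n)) τ U)))) = 0 := by
  by_cases hτ : τ = 0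
  · subst hτ
    exact Scoring.integral_pow_odd_eq_zero_of_odd _ (measurePreserving_configPerm_obcGibbs (Equiv.swap (1 : Fin 4) 2)
      (fundamentalRep (Fin n)) (continuous_fundamentalRep (Fin n)) (Equiv.swap_apply_of_ne_of_ne (by decide) (by decide)) β)
      (sum_cloverPseudoscalar_wilsonFlow_configPerm_swap t (sitePerm_swap_mem_slices W)) k
  · exact Scoring.integral_pow_odd_eq_zero_of_odd _ (measurePreserving_negReflect_obcGibbs (fundamentalRep (Fin n))
      (continuous_fundamentalRep (Fin n)) hτ β) (sum_cloverPseudoscalar_wilsonFlow_negReflect_of_symm t (negReflect_mem_slices hτ W)) k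

/-- **`⟨Q_{W,t}⟩_OBC = 0`**: the flowed slab charge has zero mean, every open direction, window, flow time (the case `k = 0`). -/
theorem obcGibbs_flowedSlabCharge_integral_eq_zero (τ : Fin 4) (W : Finset (ZMod L)) (β t : ℝ) :
    ∫ U, ∑ x ∈ Finset.univ.filter (fun y : Site 4 L => y τ ∈ W),
        cloverPseudoscalar (fundamentalRep (Fin n)) x (wilsonFlow t U)
      ∂(gibbsProbability (Measure.pi fun _ : Edge 4 L => haarProbability (Matrix.specialUnitaryGroup (Fin n) ℂ))
        (fun U => Real.exp (-(β * obcAction (fundamentalRep (Fin n)) τ U)))) = 0 := by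
  have h := obcGibbs_flowedSlabCharge_pow_odd_eq_zero (n := n) τ W β t 0
  simpa only [Nat.mul_zero, Nat.zero_add, pow_one] using h

end Law

end Summit.Ventures.LatticeQCDFlow.Exactness
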